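import Mathlib
import HarnessLib
import Summits.ValiantsHypothesis.ValiantsHypothesis.Theses.MonotoneRestoration
import Literature.Computability.AlgebraicComplexity.ArithCircuit
import Literature.Computability.AlgebraicComplexity.ArithCircuitProofs
import Literature.Computability.AlgebraicComplexity.MonotoneStructure
import Literature.Computability.AlgebraicComplexity.PermanentIrreducible
import Literature.ModelTheory.FiniteModelTheory.CkEquiv
import Summits.ValiantsHypothesis.ValiantsHypothesis.Theorems.MonotoneRestorationMonotoneRestorationQPCosetCount
import Summits.ValiantsHypothesis.ValiantsHypothesis.Theorems.MonotoneRestorationMonotoneRestorationQPSymmetricLB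
import Summits.ValiantsHypothesis.ValiantsHypothesis.Theorems.MonotoneRestorationMonotoneRestorationQPSupportSymmetrisation
import Summits.ValiantsHypothesis.ValiantsHypothesis.Theorems.MonotoneRestorationMonotoneRestorationQPSparseRegime
import Summits.ValiantsHypothesis.ValiantsHypothesis.Theorems.MonotoneRestorationMonotoneRestorationQPBeta
import Literature.Computability.AlgebraicComplexity.SymmetricArithCircuit
import Literature.Computability.AlgebraicComplexity.DawarWilsenach2025Proofs
import Literature.GroupTheory.PermutationGroups.SmallIndexSubgroups
import Summits.ValiantsHypothesis.ValiantsHypothesis.Theorems.MonotoneRestorationQP.Negative.LoadBearing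
import Summits.ValiantsHypothesis.ValiantsHypothesis.Theorems.MonotoneRestorationMonotoneRestorationQPPermSupportCount

/-! TTRL-lite variant V20213 of stmt-ValiantsHypothesis-15886 -/

-- `Summit.ValiantsHypothesis.ValiantsHypothesis.…` is the tree's mandated single-conjunct layout
-- (Sub = Summit), so the duplicated namespace component is intended.
set_option linter.dupNamespace false

namespace Summit.ValiantsHypothesis.ValiantsHypothesis.Theorems

open Summit.ValiantsHypothesis.ValiantsHypothesis.Theses.MonotoneRestoration
open Literature.Computability.AlgebraicComplexity

/-- **TTRL-lite variant V20213 of `stub_esymmRowSums_structure` (stmt-ValiantsHypothesis-15886).**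
Row-permutation invariance of `e_k` of the *weighted* row sums `R_i = Σ_j w_j · x_{i,j}`
(arbitrary column weights `w : Fin n → ℝ≥0`): renaming rows by `σ` (columns fixed) in
`bind₁ (fun i => ∑ j, C (w j) * X (i, j)) (esymm (Fin n) ℝ≥0 k)` leaves it unchanged.
Proof: `rename (σ × id) (R_i) = R_{σ i}` (`rename_C`, `rename_X`), so by `rename_bind₁` the
left side is `bind₁ (R ∘ σ) e_k = bind₁ R (rename σ e_k)` (`bind₁_rename`), and
`rename σ e_k = e_k` (`rename_esymm`). Unlike column symmetry, this needs no condition on `w`.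
[folklore] -/
theorem stub_esymmRowSums_structure_var20213 :
    ∀ (n k : ℕ) (w : Fin n → NNReal) (σ : Equiv.Perm (Fin n)),
      MvPolynomial.rename (fun p : Fin n × Fin n => (σ p.1, p.2))
        (MvPolynomial.bind₁ (fun i : Fin n => ∑ j : Fin n,
            MvPolynomial.C (w j) * MvPolynomial.X (i, j))
          (MvPolynomial.esymm (Fin n) NNReal k)) =
      MvPolynomial.bind₁ (fun i : Fin n => ∑ j : Fin n,
          MvPolynomial.C (w j) * MvPolynomial.X (i, j))
        (MvPolynomial.esymm (Fin n) NNReal k) := by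
  intro n k w σ
  have h :
      (fun i : Fin n =>
          MvPolynomial.rename (fun q : Fin n × Fin n => (σ q.1, q.2))
            (∑ j : Fin n, (MvPolynomial.C (w j) * MvPolynomial.X (i, j) :
              MvPolynomial (Fin n × Fin n) NNReal))) =
        (fun i : Fin n =>
            ∑ j : Fin n, (MvPolynomial.C (w j) * MvPolynomial.X (i, j) :
              MvPolynomial (Fin n × Fin n) NNReal)) ∘ σ := by
    funext i
    simp only [Function.comp_apply, map_sum, map_mul, MvPolynomial.rename_C,
      MvPolynomial.rename_X]
  rw [MvPolynomial.rename_bind₁, h, ← MvPolynomial.bind₁_rename, MvPolynomial.rename_esymm]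

end Summit.ValiantsHypothesis.ValiantsHypothesis.Theorems
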